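import Literature.MathematicalPhysics.PowerSystems.UnicyclicNetworkEquilibria
import Literature.Analysis.ValidatedNumerics.CodeListZeroSearchCertificate
import Mathlib.Analysis.Real.Pi.Bounds
import Mathlib.Analysis.SpecialFunctions.Trigonometric.Angle
import HarnessLib

/-!
# The loop-flow census of Chiang's three-machine system: the ONE-DIMENSIONAL route to the finite
# census of synchronous states (Delabays–Coletta–Jacquod 2016 §3 on the smallest cycle, K₃),
# checked by the kernel against the two-dimensional census

Topic `Literature/MathematicalPhysics/PowerSystems`, namespace
`Literature.MathematicalPhysics.PowerSystems.ChiangThreeMachine.LoopFlow`. A WORKED INSTANCE (and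
falsifier check) of `UnicyclicNetworkEquilibria.lean` (LADDER-GRIDFUSION line
«G2.b-SP-EQ-ISOLATION-THM»): Chiang's printed lossless 3-machine system [Chiang1995, §4.1 (4.1)]
(`P = (0, 1/20)`, `C₀₂ = 1`, `C₀₁ = C₁₂ = 1/2`, machine `2` as the pinned reference) is the complete
graph `K₃` = spanning tree {0–2, 1–2} plus the chord {0, 1}; its synchronous states are counted here
by the LOOP-FLOW route — one real unknown — instead of the two-dimensional bisection census of
`ChiangThreeMachineEquilibriumCensus.lean`, and the two routes agree (6 = 2 + 4). Everything is
PROVED (kernel `decide` on rational interval arithmetic for the two censuses; standard axioms); the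
`def`s are the network literals and certificate DATA; no named fact.

SOURCES (read on the page; locators as in `UnicyclicNetworkEquilibria.lean`).
* R. Delabays, T. Coletta, P. Jacquod, J. Math. Phys. 57 (2016) 032701 [DelabaysColettaJacquod2016]
  (arXiv:1512.04266): §3 Thm 3.6 (flows satisfying Kirchhoff's law differ by loop flows), the loop
  flow parameter («P_{i,i+1} = P*_{i,i+1} + Kε»), Def. 3.7, and p. 9 «The number of solutions is thus
  related to the number of acceptable, discrete loop flows» — here made quantitative for K₃: the
  acceptable loop flows are the zeros of two explicit one-variable functions, 2 + 4 of them.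
* F. Dörfler, M. Chertkov, F. Bullo, PNAS 110 (2013), SI §3.1 Thm 1 (1) [DorflerChertkovBullo2013].
* H.-D. Chiang, in *Systems and Control Theory for Power Systems* (1995) [Chiang1995], §4.1 eq. (4.1)
  and Table 4.1 (the six equilibria modulo 2π; cf. `ChiangThreeMachineEquilibriumCensus`).
* Kernel: R. E. Moore 1979 §6.4 bisection/exclusion procedure (6.8) and R. B. Kearfott 1987
  (Krawczyk uniqueness), as typed in `Literature.Analysis.ValidatedNumerics.zeroCount_sound`.

## The reduction (how the one unknown arises)
Pin `θ₂ = 0`. By `UnicyclicNetwork.treeSine_eq_of_equilibrium` the two tree edges of an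
equilibrium carry the tree flows of `P` loaded by the loop flow `f = ½ sin(θ₀ − θ₁)`:
`sin θ₀ = −f`, `½ sin θ₁ = 1/20 + f`. PARAMETER: the edge ANGLE `t = θ₁` of the edge that can reach
its transfer limit (at the type-two point `z₄` of Table 4.1, `sin θ₁ = 0.99989`): then
`f = ½ sin t − 1/20`, `sin θ₀ = 1/20 − ½ sin t =: sinφ₀(t)` (`|sinφ₀| ≤ 0.55`, never saturating),
`cos θ₀ = σ √(1 − sinφ₀(t)²)` on the branch `σ = sign cos θ₀ ∈ {±1}`, and the CHORD EQUATION
`½ sin(θ₀ − θ₁) = f` becomes, after `sin(θ₀ − θ₁) = sin θ₀ cos θ₁ − cos θ₀ sin θ₁`,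
`G_σ(t) := sinφ₀(t) cos t − σ √(1 − sinφ₀(t)²) sin t − sin t + 1/10 = 0`.
(The chord's cosine never enters, so ITS near-saturation at `z₅`, `sin(θ₀ − θ₁) = −0.998`, is
harmless; parametrising instead by the chord sine puts a square-root singularity `1.1·10⁻⁴` away from
`z₄` and the interval census cannot close — recorded as the design rule for larger rings.)

## What is certified
| § | decl | content |
|---|------|---------|
| L1 | `parent`, `depth`, `coupling`, `injection`, `treeFlow0`, `chordFlow` (+ `depth_parent`, `coupling_symm`, `chord_not_tree`, `coupling_support`, `coupling_parent_pos`, `treeFlow0_conservation`, `chordFlow_conservation`) | (4.1) as rooted tree + chord with its rational tree flows `w⁰ = (0, 1/20)`, `χ̂ = (1, −1)`: every hypothesis of `finite_pinned_equilibria_of_finite_loopSines`, by `decide` / `fin_cases` / `simp` |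
| L1 | `equations_of_equilibrium` | the pinned node equations ARE (4.1) with `ω = 0` |
| L2 | `loopCfg`, `sinPhi0`, `loopG σ`, `eval_loopG`, `loopBox`, `treePos`, `treeNeg`, **`count_pos`** (`= some 2`), **`count_neg`** (`= some 4`) | the two consistency functions as code lists (`FExpr 1` with `sqrt`; seed configuration with 20 square-root refinement steps) and their KERNEL CENSUSES on `t ∈ [−63/20, 63/20] ⊇ [−π, π)`: 15 + 36 leaves |
| L3 | `branch`, `cos_eq_branch_sqrt`, **`loopG_eq_zero_of_equilibrium`**, `mem_zeroSet_of_equilibrium` | every pinned equilibrium `θ` is a zero of `G_{branch θ}` at `t = θ₁`, and its chord sine is `sin θ₁ − 1/10` |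
| L4 | **`finite_pinned_equilibria`** | the pinned equilibria of the period box are FINITELY MANY — via `UnicyclicNetwork.finite_pinned_equilibria_of_finite_loopSines` with `S` = chord sines over the certified zeros (the census hypothesis of `FiniteEquilibriumSetIsolation.exists_levelIsolation_of_finite_pinned`) |
| L4 | **`ncard_pinned_equilibria_le`** | at most `2 + 4 = 6` pinned equilibria per period from the loop-flow count alone (injection `θ ↦ (θ₁, branch)`); `ChiangThreeMachineEquilibriumCensus.equilibria_mod_two_pi` gives exactly 6, the Baillieul–Byrnes bound |

Zeros found (Krawczyk boxes of the accepted traces, context only): `G₊`: `t ∈ [0.0579, 0.0615]`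
(s.e.p. `z₀`), `[3.0788, 3.1383]` (`z₁`); `G₋`: `[−3.0455, −3.0333]` (`z₃`), `[−2.0531, −2.0004]`
(`z₅`), `[0.2837, 0.3398]` (`z₂`), `[1.5807, 1.5919]` (`z₄`) — the `θ₁`-coordinates of the six
enclosures of `ChiangThreeMachineEquilibriumCensus.existsUnique_leaf`.

## Template for ring networks (model seats: WSCC9 structure-preserving ring 4–5–7–8–9–6, ★ #104′)
(1) literals `parent`/`depth`/`coupling`/`injection`/`treeFlow0`/`chordFlow` and the seven
hypothesis lemmas exactly as in §L1 (all `decide`/`fin_cases`/`simp`); (2) parameter `t` = the angle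
of ONE cycle edge `k` (prefer the most loaded), `f(t) = (w⁰_k − a_k sin t)/χ̂_k`, every other edge `i`
on the `u → v` tree path: `sin φ_i = (w⁰_i − f χ̂_i)/a_i`, `cos φ_i = σ_i √(1 − sin² φ_i)` — one code
list `G_σ` per branch pattern `σ` of those edges (`2^{L−1}` patterns, `L` = path length), obtained
from the chord equation `C_uv sin(θ_u − θ_v) = f` by the angle-addition formula along the path
(§L3 is the `L = 2` case); (3) run the search (HOME/lean/tools/lit-1/LoopFlowCensusSearch.lean, seed
configuration `loopCfg` — the library's `searchCfg` has NO square-root refinement and cannot close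
boxes under a `sqrt`), paste the traces, `decide +kernel`; (4) §L4 verbatim ⇒
`FiniteEquilibriumSetIsolation.exists_levelIsolation_of_finite_pinned` ⇒ `hiso`.

## Three columns
CERTIFIED: the table (kernel). VALIDATED: agreement of the six `θ₁`-enclosures with the 2-D census
and with Table 4.1 (context; floats printed by the untrusted search). MODELLED: Chiang's printed
(4.1) — lossless classical model, uniform… as typed in `ChiangThreeMachineRegionOfAttraction` (the
equilibrium SET does not depend on inertia/damping).

## References
* [DelabaysColettaJacquod2016] R. Delabays, T. Coletta, P. Jacquod, J. Math. Phys. 57 (2016) 032701, §3.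
* [DorflerChertkovBullo2013] F. Dörfler, M. Chertkov, F. Bullo, PNAS 110 (2013) 2005–2010, SI §3.1.
* [Chiang1995] H.-D. Chiang, The BCU method for direct stability analysis…, §4.1 (4.1), Table 4.1.
* [Moore1979] R. E. Moore, Methods and Applications of Interval Analysis, SIAM 1979, §6.4.
* [Kearfott1987] R. B. Kearfott, Abstract generalized bisection and a cost bound, Math. Comp. 49 (1987).
* [BaillieulByrnes1982] J. Baillieul, C. I. Byrnes, IEEE TCAS 29 (1982), Thm 3.1 (cite-only).

AI-produced formalisation (LADDER-GRIDFUSION seat gridfusion-lit-1 g10, 2026-08-27).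
-/

set_option autoImplicit false

/-! ## The loop-flow census of Chiang's three-machine system (K₃ = tree {0–2, 1–2} + chord {0, 1}) -/

namespace Literature.MathematicalPhysics.PowerSystems

namespace ChiangThreeMachine.LoopFlow

open Real Set NonemptyInterval Matrix Finset
open Literature.Analysis.ODE Literature.Analysis.ODE.FExpr
open Literature.Analysis.ValidatedNumerics Literature.Analysis.ValidatedNumerics.ITaylor
open Literature.MathematicalPhysics.PowerSystems.ClassicalModel.UnicyclicNetwork

/-! ### §L1. Chiang's network (4.1) as a rooted tree plus one chord -/

/-- Parent pointers of the spanning tree {0–2, 1–2} rooted at the reference node `2`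
(the root's own pointer is immaterial). [cite: Chiang1995, §4.1 eq. (4.1)] -/
def parent : Fin 3 → Fin 3 := fun _ => 2

/-- Depths: the two machines hang directly on the root. [cite: Chiang1995, §4.1 eq. (4.1)] -/
def depth : Fin 3 → ℕ := ![1, 1, 0]

/-- The lossless couplings of (4.1): `C₀₂ = 1`, `C₀₁ = C₁₂ = 1/2` (symmetric, zero diagonal).
[cite: Chiang1995, §4.1 eq. (4.1)] -/
noncomputable def coupling : Fin 3 → Fin 3 → ℝ := fun i j => (!![0, 1 / 2, 1; 1 / 2, 0, 1 / 2; 1, 1 / 2, 0] : Matrix (Fin 3) (Fin 3) ℝ) i j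

/-- The injections of (4.1): `P₀ = 0`, `P₁ = 1/20`, and the balancing `P₂ = −1/20` at the reference
node (its equation is implied by the other two). [cite: Chiang1995, §4.1 eq. (4.1)] -/
noncomputable def injection : Fin 3 → ℝ := ![0, 1 / 20, -(1 / 20)]

/-- Tree flows of the injections on the two tree edges (`w⁰₀ = P₀`, `w⁰₁ = P₁`; root entry unused).
[cite: DelabaysColettaJacquod2016, §3 Thm 3.6 (reference flow `P*`)] -/
noncomputable def treeFlow0 : Fin 3 → ℝ := ![0, 1 / 20, 0]

/-- Tree flows of the chord's unit injection `e₀ − e₁` (`χ̂₀ = 1`, `χ̂₁ = −1`; root entry unused).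
[cite: DelabaysColettaJacquod2016, §3 loop flow parameter] -/
def chordFlow : Fin 3 → ℝ := ![1, -1, 0]

/-- Depth bookkeeping of the rooted tree. [folklore] [cite: Chiang1995, §4.1 eq. (4.1)] -/
theorem depth_parent : ∀ i : Fin 3, i ≠ 2 → depth i = depth (parent i) + 1 := by decide

/-- The couplings are symmetric. [cite: Chiang1995, §4.1 eq. (4.1)] -/
theorem coupling_symm : ∀ i j : Fin 3, coupling i j = coupling j i := by
  intro i j
  fin_cases i <;> fin_cases j <;> simp [coupling]

/-- The chord {0, 1} is not a tree edge. [folklore] [cite: Chiang1995, §4.1 eq. (4.1)] -/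
theorem chord_not_tree :
    ¬(((0 : Fin 3) ≠ 2 ∧ (1 : Fin 3) = parent 0) ∨ ((1 : Fin 3) ≠ 2 ∧ (0 : Fin 3) = parent 1)) := by
  decide

/-- The couplings are supported on the tree edges and the chord. [cite: Chiang1995, §4.1 eq. (4.1)] -/
theorem coupling_support : ∀ i j : Fin 3, i ≠ j → coupling i j ≠ 0 →
    ((i ≠ 2 ∧ j = parent i) ∨ (j ≠ 2 ∧ i = parent j)) ∨ ((i = 0 ∧ j = 1) ∨ (i = 1 ∧ j = 0)) := by
  intro i j hij _
  fin_cases i <;> fin_cases j <;> simp_all [parent]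

/-- The tree edges are live: `C₀₂ = 1 > 0`, `C₁₂ = 1/2 > 0`. [cite: Chiang1995, §4.1 eq. (4.1)] -/
theorem coupling_parent_pos : ∀ i : Fin 3, i ≠ 2 → 0 < coupling i (parent i) := by
  intro i hi
  fin_cases i <;> simp_all [coupling, parent]

/-- `w⁰` are tree flows of the injections (node-wise conservation).
[cite: DelabaysColettaJacquod2016, §3 Thm 3.6] -/
theorem treeFlow0_conservation : ∀ i : Fin 3, injection i = (if i ≠ 2 then treeFlow0 i else 0)
    - ∑ j ∈ Finset.univ.filter (fun j => j ≠ 2 ∧ parent j = i), treeFlow0 j := by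
  intro i
  rw [Finset.sum_filter, Fin.sum_univ_three]
  fin_cases i <;> simp [parent, injection, treeFlow0]

/-- `χ̂` are tree flows of the chord's unit injection. [cite: DelabaysColettaJacquod2016, §3 loop flow
parameter] -/
theorem chordFlow_conservation : ∀ i : Fin 3, chordSign 0 1 i = (if i ≠ 2 then chordFlow i else 0)
    - ∑ j ∈ Finset.univ.filter (fun j => j ≠ 2 ∧ parent j = i), chordFlow j := by
  intro i
  rw [Finset.sum_filter, Fin.sum_univ_three]
  fin_cases i <;> simp [parent, chordSign, chordFlow]

/-- The nodal flow of the presentation, expanded. [cite: Chiang1995, §4.1 eq. (4.1)] -/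
theorem flow_expand (θ : Fin 3 → ℝ) (i : Fin 3) :
    ∑ j, coupling i j * Real.sin (θ i - θ j) =
      coupling i 0 * Real.sin (θ i - θ 0) + coupling i 1 * Real.sin (θ i - θ 1)
        + coupling i 2 * Real.sin (θ i - θ 2) := by
  rw [Fin.sum_univ_three]

/-- **The pinned equilibrium equations ARE Chiang's (4.1) with `ω = 0`**: with `θ₂ = 0`, the node
equations at `0` and `1` read `sin θ₀ + ½ sin(θ₀ − θ₁) = 0`, `½ sin θ₁ + ½ sin(θ₁ − θ₀) = 1/20`.
[cite: Chiang1995, §4.1 eq. (4.1)] -/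
theorem equations_of_equilibrium {θ : Fin 3 → ℝ} (hr : θ 2 = 0)
    (heq : ∀ i, ∑ j, coupling i j * Real.sin (θ i - θ j) = injection i) :
    Real.sin (θ 0) + 1 / 2 * Real.sin (θ 0 - θ 1) = 0 ∧
      1 / 2 * Real.sin (θ 1) + 1 / 2 * Real.sin (θ 1 - θ 0) = 1 / 20 := by
  have h0 := heq 0
  have h1 := heq 1
  rw [flow_expand] at h0 h1
  simp only [coupling, injection, hr, sub_zero, Matrix.cons_val_zero, Matrix.cons_val_one,
    Matrix.of_apply, Matrix.cons_val', Matrix.cons_val_fin_one, Matrix.cons_val_two,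
    Matrix.tail_cons, Matrix.head_cons, Matrix.empty_val'] at h0 h1
  constructor <;> linarith

/-! ### §L2. The two loop-flow consistency functions and their kernel censuses -/

/-- Seed configuration for code lists with square roots: `searchCfg` with 20 refinement steps of
the square-root kernel (with 0 steps `√u` on `u ⊆ (0, 1]` is only bracketed by `[u, 1]`).
[cite: Moore1979, §3.4] -/
def loopCfg : SeedCfg := ⟨40, 30, 12, 3, 20⟩

/-- `sin φ₀` as a function of the edge angle `t = θ₁`: `1/20 − ½ sin t` (the loaded tree flow of
edge 0–2 divided by `a₀ = 1`). [cite: DelabaysColettaJacquod2016, §3 «P_{i,i+1} = P*_{i,i+1} + Kε»] -/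
def sinPhi0 : FExpr 1 := sub (const (1 / 20)) (smul (1 / 2) (sin (var 0)))

/-- **Loop-flow consistency function** of branch `σ = sign cos θ₀`:
`G_σ(t) = sinφ₀(t)·cos t − σ·√(1 − sinφ₀(t)²)·sin t − sin t + 1/10`
(= `sin(θ₀ − θ₁) − 2f`, the chord equation). [cite: DelabaysColettaJacquod2016, §3 Thm 3.6 and
p. 9 «the number of solutions is … related to the number of acceptable, discrete loop flows»] -/
def loopG (σ : ℚ) : Fin 1 → FExpr 1 :=
  ![add (sub (sub (mul sinPhi0 (cos (var 0)))
      (smul σ (mul (sqrt (sub (const 1) (mul sinPhi0 sinPhi0))) (sin (var 0))))) (sin (var 0)))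
      (const (1 / 10))]

/-- Semantics of the consistency code list. [cite: Moore1979, §3.4 procedure step 1] -/
theorem eval_loopG (σ : ℚ) (x : Fin 1 → ℝ) :
    (loopG σ 0).eval x =
      (1 / 20 - 1 / 2 * Real.sin (x 0)) * Real.cos (x 0)
        - (σ : ℝ) * (Real.sqrt (1 - (1 / 20 - 1 / 2 * Real.sin (x 0)) * (1 / 20 - 1 / 2 * Real.sin (x 0)))
            * Real.sin (x 0))
        - Real.sin (x 0) + 1 / 10 := by
  simp only [loopG, sinPhi0, eval, Matrix.cons_val_zero]
  push_cast
  ring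

/-- The census box `t ∈ [−63/20, 63/20] ⊇ [−π, π)`. [cite: Moore1979, §6.4] -/
def loopBox : Fin 1 → Iv := ![⟨(-(63 / 20), 63 / 20), by decide +kernel⟩]

/-- Bisection/Krawczyk trace for `G₊` (15 leaves: 13 exclusion, 2 Krawczyk), produced by an
untrusted search and re-checked by the kernel below. [cite: Moore1979, §6.4 procedure (6.8)] -/
def treePos : BisectionTree 1 :=
  (.split 0 0 (.split 0 (-63/40) (.split 0 (-189/80) (.split 0 (-441/160) (.split 0 (-189/64) (.split 0 (-1953/640) .exclude .exclude) .exclude) .exclude) .exclude) (.split 0 (-63/80) .exclude .exclude)) (.split 0 (63/40) (.split 0 (63/80) (.split 0 (63/160) (.split 0 (63/320) (.unique ![(63/640)] !![(-424303/1048576)]) .exclude) .exclude) .exclude) (.split 0 (189/80) .exclude (.split 0 (441/160) .exclude (.split 0 (189/64) .exclude (.unique ![(1953/640)] !![(176041/262144)]))))))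

/-- Bisection/Krawczyk trace for `G₋` (36 leaves: 32 exclusion, 4 Krawczyk).
[cite: Moore1979, §6.4 procedure (6.8)] -/
def treeNeg : BisectionTree 1 :=
  (.split 0 0 (.split 0 (-63/40) (.split 0 (-189/80) (.split 0 (-441/160) (.split 0 (-189/64) (.split 0 (-1953/640) (.split 0 (-3969/1280) .exclude .exclude) (.split 0 (-3843/1280) (.unique ![(-7749/2560)] !![(-2236571/1048576)]) .exclude)) (.split 0 (-1827/640) .exclude .exclude)) (.split 0 (-819/320) .exclude .exclude)) (.split 0 (-63/32) (.split 0 (-693/320) .exclude (.split 0 (-1323/640) .exclude (.unique ![(-2583/1280)] !![(982517/524288)]))) (.split 0 (-567/320) (.split 0 (-1197/640) .exclude .exclude) .exclude))) (.split 0 (-63/80) (.split 0 (-189/160) .exclude .exclude) (.split 0 (-63/160) .exclude .exclude))) (.split 0 (63/40) (.split 0 (63/80) (.split 0 (63/160) (.split 0 (63/320) .exclude (.unique ![(189/640)] !![(-592817/262144)])) (.split 0 (189/320) .exclude .exclude)) (.split 0 (189/160) .exclude (.split 0 (441/320) .exclude (.split 0 (189/128) .exclude (.split 0 (1953/1280)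 .exclude .exclude))))) (.split 0 (189/80) (.split 0 (63/32) (.split 0 (567/320) (.split 0 (1071/640) (.split 0 (2079/1280) (.unique ![(819/512)] !![(2278583/1048576)]) .exclude) .exclude) .exclude) (.split 0 (693/320) .exclude .exclude)) (.split 0 (441/160) .exclude (.split 0 (189/64) .exclude .exclude)))))

/-- **KERNEL CENSUS, branch `cos θ₀ > 0`: exactly 2 zeros** of `G₊` on `[−63/20, 63/20]`
(the s.e.p. `θ₁ ≈ 0.060` and `θ₁ ≈ 3.108`). [cite: Moore1979, §6.4 procedure (6.8)]
[cite: Kearfott1987, abstract] -/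
theorem count_pos : zeroCount loopCfg (loopG 1) treePos loopBox = some 2 := by
  decide +kernel

/-- **KERNEL CENSUS, branch `cos θ₀ < 0`: exactly 4 zeros** of `G₋` on `[−63/20, 63/20]`
(`θ₁ ≈ −3.039, −2.027, 0.312, 1.586`). [cite: Moore1979, §6.4 procedure (6.8)]
[cite: Kearfott1987, abstract] -/
theorem count_neg : zeroCount loopCfg (loopG (-1)) treeNeg loopBox = some 4 := by
  decide +kernel

/-! ### §L3. Every pinned equilibrium is a zero of its branch's consistency function -/

/-- The branch of an angle configuration: `+1` if `cos θ₀ ≥ 0`, else `−1`. [folklore]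
[cite: DelabaysColettaJacquod2016, Def. 3.7] -/
noncomputable def branch (θ : Fin 3 → ℝ) : ℚ := if 0 ≤ Real.cos (θ 0) then 1 else -1

/-- `cos θ₀ = σ √(1 − sin² θ₀)` on branch `σ`. [folklore] [cite: DelabaysColettaJacquod2016, Def. 3.7] -/
theorem cos_eq_branch_sqrt (θ : Fin 3 → ℝ) :
    Real.cos (θ 0) = (branch θ : ℝ) *
      Real.sqrt (1 - Real.sin (θ 0) * Real.sin (θ 0)) := by
  have hsq : 1 - Real.sin (θ 0) * Real.sin (θ 0) = Real.cos (θ 0) ^ 2 := by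
    nlinarith [Real.sin_sq_add_cos_sq (θ 0)]
  rw [hsq, Real.sqrt_sq_eq_abs]
  unfold branch
  split_ifs with h
  · push_cast; rw [one_mul, abs_of_nonneg h]
  · push_cast; rw [abs_of_neg (lt_of_not_ge h)]; ring

/-- **Equilibrium ⇒ zero of `G_σ` at `t = θ₁`, and the chord sine is `sin θ₁ − 1/10`.**
[cite: DelabaysColettaJacquod2016, §3 Thm 3.6] [cite: DorflerChertkovBullo2013, SI §3.1 Thm 1 (1)] -/
theorem loopG_eq_zero_of_equilibrium {θ : Fin 3 → ℝ} (hr : θ 2 = 0)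
    (heq : ∀ i, ∑ j, coupling i j * Real.sin (θ i - θ j) = injection i) :
    (loopG (branch θ) 0).eval ![θ 1] = 0 ∧ Real.sin (θ 0 - θ 1) = Real.sin (θ 1) - 1 / 10 := by
  obtain ⟨h0, h1⟩ := equations_of_equilibrium hr heq
  have hanti : Real.sin (θ 1 - θ 0) = -Real.sin (θ 0 - θ 1) := by
    rw [← Real.sin_neg, neg_sub]
  have hs : Real.sin (θ 0 - θ 1) = Real.sin (θ 1) - 1 / 10 := by linarith
  have hsin0 : Real.sin (θ 0) = 1 / 20 - 1 / 2 * Real.sin (θ 1) := by linarith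
  refine ⟨?_, hs⟩
  rw [eval_loopG]
  simp only [Matrix.cons_val_zero]
  have hcos := cos_eq_branch_sqrt θ
  rw [hsin0] at hcos
  have hprod : (branch θ : ℝ) * (Real.sqrt (1 - (1 / 20 - 1 / 2 * Real.sin (θ 1)) *
      (1 / 20 - 1 / 2 * Real.sin (θ 1))) * Real.sin (θ 1)) = Real.cos (θ 0) * Real.sin (θ 1) := by
    rw [hcos]; ring
  rw [hprod]
  have := Real.sin_sub (θ 0) (θ 1)
  rw [hsin0] at this
  linarith

/-- Membership in the census box in real coordinates. [folklore] [cite: Moore1979, §2.1] -/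
private theorem mem_loopBox_iff (z : Fin 1 → ℝ) :
    z ∈ boxSet (castBox loopBox) ↔ (-(63 / 20) : ℝ) ≤ z 0 ∧ z 0 ≤ 63 / 20 := by
  rw [mem_boxSet_iff]
  simp only [Fin.forall_fin_one, loopBox, castBox_apply, mem_ratCast_iff, Matrix.cons_val_zero]
  push_cast
  exact Iff.rfl

/-- A pinned equilibrium of the period box gives a point of the zero set of `G_{branch}`.
[cite: DelabaysColettaJacquod2016, §3 Thm 3.6] [cite: Moore1979, §6.4] -/
theorem mem_zeroSet_of_equilibrium {θ : Fin 3 → ℝ} (hr : θ 2 = 0) (hbox : ∀ i, θ i ∈ Ico (-π) π)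
    (heq : ∀ i, ∑ j, coupling i j * Real.sin (θ i - θ j) = injection i) :
    (![θ 1] : Fin 1 → ℝ) ∈ zeroSet (loopG (branch θ)) loopBox := by
  refine ⟨?_, ?_⟩
  · rw [mem_loopBox_iff]
    simp only [Matrix.cons_val_zero]
    obtain ⟨h1, h2⟩ := hbox 1
    constructor <;> nlinarith [Real.pi_gt_d2, Real.pi_lt_d2]
  · funext i
    fin_cases i
    exact (loopG_eq_zero_of_equilibrium hr heq).1

/-! ### §L4. Finiteness of the pinned synchronous states by the unicyclic reduction, and the count -/

/-- **The loop-flow census closes the census hypothesis of `FiniteEquilibriumSetIsolation` for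
Chiang's system by the ONE-DIMENSIONAL route**: the pinned (`θ₂ = 0`) equilibria of the period box
`[−π, π)³` are finitely many — obtained from `UnicyclicNetwork.finite_pinned_equilibria_of_finite_loopSines`
with `S` = the chord sines `sin t − 1/10` over the `2 + 4` certified zeros `t` of `G₊`, `G₋`.
[cite: DelabaysColettaJacquod2016, §3 Thm 3.6, p. 9] [cite: DorflerChertkovBullo2013, SI §3.1 Thm 1 (1)]
[cite: Chiang1995, §4.1 Table 4.1] -/
theorem finite_pinned_equilibria :
    {θ : Fin 3 → ℝ | θ 2 = 0 ∧ (∀ i, θ i ∈ Ico (-π) π) ∧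
      ∀ i, ∑ j, coupling i j * Real.sin (θ i - θ j) = injection i}.Finite := by
  classical
  obtain ⟨Zp, -, hZp, -⟩ := zeroCount_sound treePos loopBox count_pos
  obtain ⟨Zn, -, hZn, -⟩ := zeroCount_sound treeNeg loopBox count_neg
  refine finite_pinned_equilibria_of_finite_loopSines depth_parent coupling coupling_symm
    (u := 0) (v := 1) (by decide) chord_not_tree coupling_support coupling_parent_pos injection
    treeFlow0 chordFlow treeFlow0_conservation chordFlow_conservation
    ((Zp ∪ Zn).image fun z => Real.sin (z 0) - 1 / 10) ?_
  intro θ hr hbox heq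
  rw [(loopG_eq_zero_of_equilibrium hr heq).2, Finset.mem_image]
  refine ⟨![θ 1], ?_, by simp⟩
  have hz := mem_zeroSet_of_equilibrium hr hbox heq
  rw [Finset.mem_union, hZp, hZn]
  unfold branch at hz
  split_ifs at hz with h
  · exact Or.inl hz
  · exact Or.inr hz

/-- **At most `2 + 4 = 6` pinned synchronous states per period** by the loop-flow count alone
(injection `θ ↦ (θ₁, branch)` into the certified zeros; the two-dimensional census of
`ChiangThreeMachineEquilibriumCensus` and the Baillieul–Byrnes bound give exactly 6).
[cite: DelabaysColettaJacquod2016, p. 9] [cite: Chiang1995, §4.1 Table 4.1]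
[cite: BaillieulByrnes1982, Thm 3.1] -/
theorem ncard_pinned_equilibria_le :
    {θ : Fin 3 → ℝ | θ 2 = 0 ∧ (∀ i, θ i ∈ Ico (-π) π) ∧
      ∀ i, ∑ j, coupling i j * Real.sin (θ i - θ j) = injection i}.ncard ≤ 6 := by
  classical
  obtain ⟨Zp, hcp, hZp, -⟩ := zeroCount_sound treePos loopBox count_pos
  obtain ⟨Zn, hcn, hZn, -⟩ := zeroCount_sound treeNeg loopBox count_neg
  set E : Set (Fin 3 → ℝ) := {θ : Fin 3 → ℝ | θ 2 = 0 ∧ (∀ i, θ i ∈ Ico (-π) π) ∧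
      ∀ i, ∑ j, coupling i j * Real.sin (θ i - θ j) = injection i} with hE
  set T : Finset ((Fin 1 → ℝ) × Bool) := Zp ×ˢ {true} ∪ Zn ×ˢ {false} with hT
  have hTcard : T.card ≤ 6 := by
    calc T.card ≤ (Zp ×ˢ ({true} : Finset Bool)).card + (Zn ×ˢ ({false} : Finset Bool)).card :=
          Finset.card_union_le _ _
      _ = 6 := by rw [Finset.card_product, Finset.card_product, hcp, hcn]; rfl
  set key : (Fin 3 → ℝ) → (Fin 1 → ℝ) × Bool := fun θ =>
    (![θ 1], decide (0 ≤ Real.cos (θ 0))) with hkey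
  have hmaps : Set.MapsTo key E ↑T := by
    rintro θ ⟨hr, hbox, heq⟩
    have hz := mem_zeroSet_of_equilibrium hr hbox heq
    simp only [hT, Finset.coe_union, Finset.coe_product, Finset.coe_singleton, Set.mem_union,
      Set.mem_prod, Set.mem_singleton_iff, hkey, Finset.mem_coe]
    unfold branch at hz
    by_cases h : 0 ≤ Real.cos (θ 0)
    · rw [if_pos h] at hz
      exact Or.inl ⟨(hZp _).2 hz, by simp [h]⟩
    · rw [if_neg h] at hz
      exact Or.inr ⟨(hZn _).2 hz, by simp [h]⟩
  have hinj : Set.InjOn key E := by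
    rintro θ ⟨hr, hbox, heq⟩ θ' ⟨hr', hbox', heq'⟩ hk
    have h1 : θ 1 = θ' 1 := by
      have := congrArg (fun p => p.1 0) hk
      simpa [hkey] using this
    have hc : (0 ≤ Real.cos (θ 0) ↔ 0 ≤ Real.cos (θ' 0)) := by
      have := congrArg Prod.snd hk
      simpa only [hkey, decide_eq_decide] using this
    have hs0 : Real.sin (θ 0) = Real.sin (θ' 0) := by
      obtain ⟨a, -⟩ := equations_of_equilibrium hr heq
      obtain ⟨a', -⟩ := equations_of_equilibrium hr' heq'
      have e1 := (loopG_eq_zero_of_equilibrium hr heq).2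
      have e2 := (loopG_eq_zero_of_equilibrium hr' heq').2
      rw [h1] at a e1
      linarith
    have hc0 : Real.cos (θ 0) = Real.cos (θ' 0) := by
      rw [cos_eq_branch_sqrt θ, cos_eq_branch_sqrt θ', hs0]
      unfold branch
      by_cases h : 0 ≤ Real.cos (θ 0)
      · rw [if_pos h, if_pos (hc.1 h)]
      · rw [if_neg h, if_neg (fun h' => h (hc.2 h'))]
    -- θ 0 and θ' 0 agree modulo 2π (equal sine and cosine), hence agree in the period box
    have h0 : θ 0 = θ' 0 := by
      obtain ⟨k, hk⟩ := Real.Angle.angle_eq_iff_two_pi_dvd_sub.1 (Real.Angle.cos_sin_inj hc0 hs0)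
      obtain ⟨a1, a2⟩ := hbox 0
      obtain ⟨b1, b2⟩ := hbox' 0
      have hk0 : k = 0 := by
        have hlt : |(k : ℝ)| < 1 := by
          rw [abs_lt]; constructor <;> nlinarith [Real.pi_pos]
        have : |k| < 1 := by exact_mod_cast hlt
        rw [abs_lt] at this; omega
      rw [hk0] at hk; simp at hk; linarith
    funext i
    fin_cases i
    · exact h0
    · exact h1
    · exact hr.trans hr'.symm
  calc E.ncard ≤ (↑T : Set ((Fin 1 → ℝ) × Bool)).ncard :=
        Set.ncard_le_ncard_of_injOn key hmaps hinj (Finset.finite_toSet T)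
    _ = T.card := Set.ncard_coe_finset T
    _ ≤ 6 := hTcard

end ChiangThreeMachine.LoopFlow

end Literature.MathematicalPhysics.PowerSystems
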